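import Summits.CriticalPhenomena.SAWScalingLimit.Theorems.SAWTotalPositivityBoundaryTP2Continuity
import Summits.CriticalPhenomena.SAWScalingLimit.Theorems.SAWLeftRightFKGLeftRightFKGThreePointDefs
import HarnessLib

/-!
# `ThreePointAt x_c` from `ThreePointAt x` below `x_c`, and the crux from subcritical inputs
# (crux `LeftRightFKG`, stmt-CriticalPhenomena-11232, line `corner-localisation`, skeleton v7)

Lead c2 (prover-line-stmt-CriticalPhenomena-11232-c2-0, 2026-08-16). The `x`-structure of the new open stub
`stub_threePoint = ThreePointAt x_c` (vocabulary `…ThreePointDefs`): with `…ThreePointSupercritical`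
(`¬ ThreePointAt x` for `x_c < x < 1`) the admissible set `{x ∈ (0,1) : ThreePointAt x}` lies in `(0, x_c]`; this file
adds that it is CLOSED FROM BELOW at `x_c`:

* `pathKernel_threePoint_iff` — for `x ≥ 0` the `ℝ≥0∞` inequality `Z(w,p)Z(w,q) ≤ Z(p,q)` is equivalent to the same
  inequality between the real path polynomials `Σ_γ x^{|γ|}` (finite sums);
* `threePointAt_criticalFugacity_of_subcritical` — `(∀ 0 < x < x_c, ThreePointAt x) → ThreePointAt x_c`
  (both sides are polynomial in `x`; `x_c ∈ closure (0, x_c)`; `le_on_closure`), verbatim the sibling's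
  `graphTP2At_criticalFugacity_of_subcritical` for the core;
* `leftRightFKG_of_subcritical'` — the crux from the two cores at SUBCRITICAL fugacities:
  `(∀ 0 < x < x_c, GraphTP2At x) → (∀ 0 < x < x_c, ThreePointAt x) → LeftRightFKG`.

Everything proved; registered sub-goal `stub_threePointContinuity`. [folklore]
-/

noncomputable section

namespace Summit.CriticalPhenomena.SAWScalingLimit.Theorems.LeftRightFKG.ThreePoint

open SimpleGraph Literature.Probability.LatticeModels Literature.Probability.RandomPlanarGeometry
open Summit.CriticalPhenomena.SAWScalingLimit.Theorems.BoundaryTP2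
open scoped ENNReal

variable {V : Type*} {H : SimpleGraph V}

/-- For `x ≥ 0`, the three-point inequality of the `ℝ≥0∞` kernels is equivalent to the three-point inequality of
the real path polynomials. [folklore] -/
theorem pathKernel_threePoint_iff {x : ℝ} (hx : 0 ≤ x) (w p q : V) [Fintype (H.Path w p)]
    [Fintype (H.Path w q)] [Fintype (H.Path p q)] :
    pathKernel H x w p * pathKernel H x w q ≤ pathKernel H x p q ↔
      (∑ γ : H.Path w p, x ^ γ.1.length) * (∑ γ : H.Path w q, x ^ γ.1.length) ≤
        ∑ γ : H.Path p q, x ^ γ.1.length := by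
  rw [pathKernel_eq_ofReal_pathSum hx, pathKernel_eq_ofReal_pathSum hx, pathKernel_eq_ofReal_pathSum hx,
    ← ENNReal.ofReal_mul (pathSum_nonneg hx _ _), ENNReal.ofReal_le_ofReal_iff (pathSum_nonneg hx _ _)]

/-- **`ThreePointAt x_c` from `ThreePointAt` below `x_c`.** If the three-point splitting inequality holds at every
subcritical fugacity `0 < x < x_c`, then it holds at `x_c` (for a fixed finite instance both sides are polynomial
in `x`, and `x_c > 0` is a limit of subcritical fugacities). [folklore] -/
theorem threePointAt_criticalFugacity_of_subcritical
    (h : ∀ x : ℝ, 0 < x → x < SAW.criticalFugacity → ThreePointAt x) :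
    ThreePointAt SAW.criticalFugacity := by
  intro H hH hfin w w' p q hww' hw' hwp hwq hpq
  have hxc : 0 < SAW.criticalFugacity := SAW.criticalFugacity_pos_lt_one'.1
  haveI : ∀ a b, Fintype (H.Path a b) := fun a b =>
    @Fintype.ofFinite (H.Path a b) (finite_path hfin a b)
  rw [pathKernel_threePoint_iff hxc.le]
  have hsub : ∀ x ∈ Set.Ioo 0 SAW.criticalFugacity,
      (∑ γ : H.Path w p, x ^ γ.1.length) * (∑ γ : H.Path w q, x ^ γ.1.length) ≤
        ∑ γ : H.Path p q, x ^ γ.1.length := by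
    intro x hx
    exact (pathKernel_threePoint_iff hx.1.le w p q).1
      (h x hx.1 hx.2 H hH hfin w w' p q hww' hw' hwp hwq hpq)
  have hmem : SAW.criticalFugacity ∈ closure (Set.Ioo 0 SAW.criticalFugacity) := by
    rw [closure_Ioo hxc.ne]
    exact ⟨hxc.le, le_rfl⟩
  exact le_on_closure (f := fun x : ℝ =>
      (∑ γ : H.Path w p, x ^ γ.1.length) * (∑ γ : H.Path w q, x ^ γ.1.length))
    (g := fun x : ℝ => ∑ γ : H.Path p q, x ^ γ.1.length)
    hsub ((continuous_pathSum w p).mul (continuous_pathSum w q)).continuousOn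
    (continuous_pathSum p q).continuousOn hmem

/-- **The crux from the two cores at subcritical fugacities**: if `GraphTP2At x` and `ThreePointAt x` hold for
every `0 < x < x_c`, then `LeftRightFKG` (continuity to `x_c` for both, then
`leftRightFKG_of_graphTP2At_of_threePointAt`). [folklore] -/
theorem leftRightFKG_of_subcritical'
    (h₁ : ∀ x : ℝ, 0 < x → x < SAW.criticalFugacity → GraphTP2At x)
    (h₂ : ∀ x : ℝ, 0 < x → x < SAW.criticalFugacity → ThreePointAt x) :
    Summit.CriticalPhenomena.SAWScalingLimit.Theses.SAWLeftRightFKG.LeftRightFKG :=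
  leftRightFKG_of_graphTP2At_of_threePointAt (graphTP2At_criticalFugacity_of_subcritical h₁)
    (threePointAt_criticalFugacity_of_subcritical h₂)

/-- REGISTERED SUB-GOAL `stub_threePointContinuity` of line `corner-localisation` (lead c2): the open stub
`stub_threePoint = ThreePointAt x_c` follows from the three-point inequality at all subcritical fugacities. [folklore] -/
theorem stub_threePointContinuity :
    (∀ x : ℝ, 0 < x → x < SAW.criticalFugacity → ThreePointAt x) → ThreePointAt SAW.criticalFugacity :=
  threePointAt_criticalFugacity_of_subcritical

end Summit.CriticalPhenomena.SAWScalingLimit.Theorems.LeftRightFKG.ThreePoint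

end
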